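import Literature.GroupTheory.CombinatorialGroupTheory.PuncturedSurfaceGroupFiniteIndexSubgroupHolds
import Literature.GroupTheory.CombinatorialGroupTheory.PuncturedSurfaceGroupFreeCuspActions
import Literature.GroupTheory.CombinatorialGroupTheory.PuncturedSurfaceGroupNodeLoopBasis
import HarnessLib

/-!
# Distinct cusps of a finite covering of a once-punctured surface are separated by a Heisenberg quotient

Topic `Literature/GroupTheory/CombinatorialGroupTheory`; theorems only.  A consequence of the (proved)
named fact `PuncturedSurfaceGroupFiniteIndexSubgroup` (Hoare–Karrass–Solitar, Math. Z. 120 (1971) Thm 1;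
Zieschang–Vogt–Coldewey LNM 835 Thm 4.14.1 — finite-index subgroups of `Γ_{g,r}` are `Γ_{g',r'}` with
the induced peripheral structure, `puncturedSurfaceGroupFiniteIndexSubgroup_holds`)
[cite: ZieschangVogtColdewey1980, Thm 4.14.1 p.150] combined with the Heisenberg quotient of a
once-punctured surface group (`exists_hom_heisenberg_surjective`).

**Theorem `exists_hom_heisenberg_separating_peripheral`.**  Let `h ≥ 1`, `Γ = Γ_{h,1}` (one cusp `c₀`,
a product of commutators), `K ≤ Γ` of finite index, and `β ∈ Γ` with `K·β·⟨c₀⟩ ≠ K·⟨c₀⟩` (two DISTINCT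
cusps of the covering `K\ℍ` over the cusp of the base).  Then for every `ℓ ≥ 2` there is a homomorphism
`τ : K → H_ℓ` to the Heisenberg group mod `ℓ` (order `ℓ³`) which KILLS the peripheral subgroup
`K ∩ β⟨c₀⟩β⁻¹` of the second cusp and is NONTRIVIAL on the peripheral subgroup `K ∩ ⟨c₀⟩` of the first.
Proof: `K ≅ Γ_{g',r'}` carrying the two peripheral subgroups to (conjugates of) two DISTINCT standard
cusp subgroups `⟨c'_{j₁}⟩ ≠ ⟨c'_{j₂}⟩`; `r' ≤ [Γ:K]` (distinct cusps of the covering give distinct sheets)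
and the Riemann–Hurwitz count `2g' + r' + 2[Γ:K] = [Γ:K](2h+1) + 2` force `g' ≥ 1`; collapse every cusp
but `c'_{j₁}` (`Γ_{g',r'} → Γ_{g',1}`) and map `Γ_{g',1}` onto `H_ℓ` with `c₀ ↦ z⁻¹` central of order `ℓ`.
Why nonabelian: when the covering surface has exactly the two cusps, their loops are inverse to each other
modulo commutators, so no abelian quotient separates them.  Consumer: [CombGC] Prop. 1.2, proof p. 9 —
separating the two node branches at a level component WITHOUT cusps [cite: MochizukiCombGC2007, Prop 1.2 proof p.9].

* `exists_hom_collapseCusps` — the homomorphism `Γ_{g,r} → Γ_{g,1}` keeping one chosen cusp.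
Elementary modulo the named fact; 0 definitions; nothing here concerns [IUTchIII].
-/

namespace Literature.GroupTheory.CombinatorialGroupTheory.PuncturedSurfaceGroup

open Multiplicative

variable {g r : ℕ}

/-- **Collapsing all cusps but one**: the homomorphism `Γ_{g,r} → Γ_{g,1}` with `c_{j₁} ↦ c₀`, `c_j ↦ 1`
(`j ≠ j₁`), `a_i ↦ a_i`, `b_i ↦ b_i` (fill in the other punctures). [cite: ZieschangVogtColdewey1980, Thm 4.14.1 p.150] -/
theorem exists_hom_collapseCusps (j₁ : Fin r) :
    ∃ κ : PuncturedSurfaceGroup g r →* PuncturedSurfaceGroup g 1,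
      κ (c j₁) = c 0 ∧ (∀ j, j ≠ j₁ → κ (c j) = 1) ∧ (∀ i, κ (a i) = a i) ∧ ∀ i, κ (b i) = b i := by
  classical
  let F : puncturedSurfaceGen g r → PuncturedSurfaceGroup g 1 :=
    Sum.elim (fun ib => if ib.2 then b ib.1 else a ib.1) (fun j => if j = j₁ then c 0 else 1)
  have hFa : ∀ i, F (Sum.inl (i, false)) = a i := fun i => by simp [F]
  have hFb : ∀ i, F (Sum.inl (i, true)) = b i := fun i => by simp [F]
  have hrel : ∀ w ∈ ({relator g r} : Set (FreeGroup (puncturedSurfaceGen g r))), FreeGroup.lift F w = 1 := by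
    intro w hw
    rw [Set.mem_singleton_iff] at hw
    rw [hw, lift_relator]
    have h1 : ((List.finRange g).map fun i =>
        F (Sum.inl (i, false)) * F (Sum.inl (i, true)) * (F (Sum.inl (i, false)))⁻¹ *
          (F (Sum.inl (i, true)))⁻¹).prod =
        ((List.finRange g).map fun i : Fin g => a (r := 1) i * b i * (a i)⁻¹ * (b i)⁻¹).prod := by
      congr 1
    have h2 : ((List.finRange r).map fun j => F (Sum.inr j)).prod = c 0 := by
      have e : (fun j : Fin r => F (Sum.inr j)) = fun j => if j = j₁ then (fun _ : Fin r => c (g := g) (0 : Fin 1)) j else 1 := by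
        funext j
        simp [F]
      rw [e, prod_map_finRange_ite_eq_single]
    rw [h1, h2]
    have h3 := comm_prod_mul_cusp_prod_eq_one (g := g) (r := 1)
    have h4 : ((List.finRange 1).map fun j : Fin 1 => c (g := g) j).prod = c 0 := by
      simp [List.finRange_succ]
    rw [h4] at h3
    exact h3
  refine ⟨PresentedGroup.toGroup hrel, ?_, fun j hj => ?_, fun i => ?_, fun i => ?_⟩
  · rw [c, PresentedGroup.toGroup.of]
    simp [F]
  · rw [c, PresentedGroup.toGroup.of]
    simp [F, hj]
  · rw [a, PresentedGroup.toGroup.of, hFa]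
  · rw [b, PresentedGroup.toGroup.of, hFb]

/-- **Distinct cusps of a finite covering of a once-punctured surface are separated by a Heisenberg
quotient.**  `h ≥ 1`, `K ≤ Γ_{h,1}` of finite index, `β ∉ K·⟨c₀⟩`, `ℓ ≥ 2`: there is a homomorphism `τ`
from `K` to the Heisenberg group mod `ℓ` (order `ℓ³`) killing `K ∩ β⟨c₀⟩β⁻¹` and nontrivial on
`K ∩ ⟨c₀⟩`. [cite: ZieschangVogtColdewey1980, Thm 4.14.1 p.150] -/
theorem exists_hom_heisenberg_separating_peripheral {h : ℕ} (hh : 1 ≤ h) (ℓ : ℕ) [Fact (1 < ℓ)]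
    (K : Subgroup (PuncturedSurfaceGroup h 1)) [hK : K.FiniteIndex] (β : PuncturedSurfaceGroup h 1)
    (hβ : ∀ k ∈ K, ∀ z ∈ cuspInertia (0 : Fin 1), β ≠ k * z) :
    ∃ (σ : Multiplicative (ZMod ℓ) →* MulAut (Multiplicative (ZMod ℓ × ZMod ℓ)))
      (τ : K →* (Multiplicative (ZMod ℓ × ZMod ℓ) ⋊[σ] Multiplicative (ZMod ℓ))),
      Nat.card (Multiplicative (ZMod ℓ × ZMod ℓ) ⋊[σ] Multiplicative (ZMod ℓ)) = ℓ ^ 3 ∧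
      (∀ (x : PuncturedSurfaceGroup h 1) (hxK : x ∈ K),
        x ∈ (cuspInertia (0 : Fin 1)).map (MulAut.conj β).toMonoidHom → τ ⟨x, hxK⟩ = 1) ∧
      ∃ (x : PuncturedSurfaceGroup h 1) (hxK : x ∈ K), x ∈ cuspInertia (0 : Fin 1) ∧ τ ⟨x, hxK⟩ ≠ 1 := by
  classical
  haveI : NeZero ℓ := ⟨by have := (Fact.out : 1 < ℓ); omega⟩
  have hyp : IsHyperbolicType h 1 := by unfold IsHyperbolicType; omega
  obtain ⟨g', r', θ, cusp, rep, hhyp', hθinj, hθrange, hformula, hcusps, hbij⟩ :=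
    puncturedSurfaceGroupFiniteIndexSubgroup_holds h 1 hyp K hK
  -- the two cusps of the covering: `j₁` over the sheet of `1`, `j₂` over the sheet of `β`
  obtain ⟨j₁, ⟨-, k₁, hk₁, z₁, hz₁, hrep₁⟩, huniq₁⟩ := hbij 0 1
  obtain ⟨j₂, ⟨-, k₂, hk₂, z₂, hz₂, hrep₂⟩, -⟩ := hbij 0 β
  have hj : j₁ ≠ j₂ := by
    intro hj
    subst hj
    -- `k₁ · 1 · z₁ = k₂ · β · z₂` puts `β` in `K⟨c₀⟩`
    refine hβ (k₂⁻¹ * k₁) (K.mul_mem (K.inv_mem hk₂) hk₁) (z₁ * z₂⁻¹)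
      ((cuspInertia 0).mul_mem hz₁ ((cuspInertia 0).inv_mem hz₂)) ?_
    have e : k₁ * 1 * z₁ = k₂ * β * z₂ := hrep₁.symm.trans hrep₂
    calc β = k₂⁻¹ * (k₂ * β * z₂) * z₂⁻¹ := by group
      _ = k₂⁻¹ * (k₁ * 1 * z₁) * z₂⁻¹ := by rw [e]
      _ = k₂⁻¹ * k₁ * (z₁ * z₂⁻¹) := by group
  -- `r' ≤ [Γ : K]`: distinct cusps of the covering lie on distinct sheets
  have hsub : ∀ j : Fin 1, j = 0 := fun j => Fin.eq_zero j
  have hr'd : r' ≤ K.index := by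
    let sh : Fin r' → PuncturedSurfaceGroup h 1 ⧸ K := fun j' => QuotientGroup.mk (rep j')⁻¹
    have hinj : Function.Injective sh := by
      intro i₁ i₂ he
      have hmem : ((rep i₁)⁻¹)⁻¹ * (rep i₂)⁻¹ ∈ K := QuotientGroup.eq.mp he
      rw [inv_inv] at hmem
      obtain ⟨j', -, huniq⟩ := hbij (cusp i₁) (rep i₁)
      have h1 : i₁ = j' := huniq i₁ ⟨rfl, 1, K.one_mem, 1, (cuspInertia _).one_mem, by group⟩
      have h2 : i₂ = j' := huniq i₂ ⟨by rw [hsub (cusp i₂), hsub (cusp i₁)],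
        (rep i₁ * (rep i₂)⁻¹)⁻¹, K.inv_mem hmem, 1, (cuspInertia _).one_mem, by group⟩
      rw [h1, h2]
    have hc := Nat.card_le_card_of_injective sh hinj
    rwa [Nat.card_eq_fintype_card, Fintype.card_fin] at hc
  -- hence `g' ≥ 1`
  have hr'2 : 2 ≤ r' := by
    have h1 := j₁.2
    have h2 := j₂.2
    have h3 : (j₁ : ℕ) ≠ j₂ := fun e => hj (Fin.ext e)
    omega
  have hg' : 0 < g' := by
    have h3 : K.index * 3 ≤ K.index * (2 * h + 1) := Nat.mul_le_mul_left _ (by omega)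
    omega
  -- the Heisenberg quotient through the cusp `j₁`
  obtain ⟨κ, hκ₁, hκ₂, -, -⟩ := exists_hom_collapseCusps (g := g') j₁
  obtain ⟨σ, f, hσ, -, hfc⟩ := exists_hom_heisenberg_surjective hg' ℓ
  let z : Multiplicative (ZMod ℓ × ZMod ℓ) ⋊[σ] Multiplicative (ZMod ℓ) :=
    SemidirectProduct.inl (ofAdd (0, 1))
  have hz1 : z ≠ 1 := by
    intro hz
    have h1 : (ofAdd ((0 : ZMod ℓ), (1 : ZMod ℓ))) = 1 :=
      SemidirectProduct.inl_injective (hz.trans (map_one _).symm)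
    have h2 := congrArg (fun q => (toAdd q).2) h1
    simp only [toAdd_ofAdd, toAdd_one, Prod.snd_zero] at h2
    exact one_ne_zero h2
  -- transport to `K` along `θ : Γ_{g',r'} ≅ K`
  let eθ : PuncturedSurfaceGroup g' r' ≃* K :=
    (MonoidHom.ofInjective hθinj).trans (MulEquiv.subgroupCongr hθrange)
  have heθ : ∀ w, ((eθ w : K) : PuncturedSurfaceGroup h 1) = θ w := fun _ => rfl
  let τ : K →* (Multiplicative (ZMod ℓ × ZMod ℓ) ⋊[σ] Multiplicative (ZMod ℓ)) :=
    (f.comp κ).comp eθ.symm.toMonoidHom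
  have hτθ : ∀ w, τ (eθ w) = f (κ w) := fun w => by
    change f (κ (eθ.symm (eθ w))) = f (κ w)
    rw [MulEquiv.symm_apply_apply]
  -- a generator `θ(c'_{j'})` of the peripheral subgroup over the sheet of `rep j'`
  have hperiph : ∀ (j' : Fin r') (x : PuncturedSurfaceGroup h 1),
      x ∈ peripheralSubgroup K (cusp j') (rep j') → ∃ n : ℤ, x = θ (c j' ^ n) := by
    intro j' x hx
    rw [← hcusps j'] at hx
    obtain ⟨w, hw, rfl⟩ := Subgroup.mem_map.mp hx
    obtain ⟨n, rfl⟩ := Subgroup.mem_zpowers_iff.mp hw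
    exact ⟨n, rfl⟩
  have hcard : Nat.card (Multiplicative (ZMod ℓ × ZMod ℓ) ⋊[σ] Multiplicative (ZMod ℓ)) = ℓ ^ 3 := by
    rw [Nat.card_congr SemidirectProduct.equivProd, Nat.card_prod, Nat.card_congr Multiplicative.toAdd,
      Nat.card_prod, Nat.card_zmod, Nat.card_congr Multiplicative.toAdd, Nat.card_zmod]
    ring
  refine ⟨σ, τ, hcard, fun x hxK hxβ => ?_, ?_⟩
  · -- `x ∈ K ∩ β⟨c₀⟩β⁻¹`: conjugating by `k₂ ∈ K` lands in the peripheral subgroup of `rep j₂ = k₂ β z₂`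
    have hx' : k₂ * x * k₂⁻¹ ∈ peripheralSubgroup K (cusp j₂) (rep j₂) := by
      refine Subgroup.mem_inf.mpr ⟨K.mul_mem (K.mul_mem hk₂ hxK) (K.inv_mem hk₂), ?_⟩
      rw [hsub (cusp j₂), hrep₂]
      obtain ⟨y, hy, rfl⟩ := Subgroup.mem_map.mp hxβ
      refine Subgroup.mem_map.mpr ⟨z₂⁻¹ * y * z₂, ?_, ?_⟩
      · exact (cuspInertia 0).mul_mem ((cuspInertia 0).mul_mem ((cuspInertia 0).inv_mem hz₂) hy) hz₂
      · simp only [MulEquiv.coe_toMonoidHom, MulAut.conj_apply]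
        group
    obtain ⟨n, hn⟩ := hperiph j₂ _ hx'
    have hk₂x : (⟨k₂ * x * k₂⁻¹, K.mul_mem (K.mul_mem hk₂ hxK) (K.inv_mem hk₂)⟩ : K) = eθ (c j₂ ^ n) :=
      Subtype.ext (by rw [heθ]; exact hn)
    have h1 : τ ⟨k₂ * x * k₂⁻¹, K.mul_mem (K.mul_mem hk₂ hxK) (K.inv_mem hk₂)⟩ = 1 := by
      rw [hk₂x, hτθ, map_zpow, map_zpow, hκ₂ j₂ (Ne.symm hj), map_one, one_zpow]
    have h2 : (⟨k₂ * x * k₂⁻¹, K.mul_mem (K.mul_mem hk₂ hxK) (K.inv_mem hk₂)⟩ : K) =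
        ⟨k₂, hk₂⟩ * ⟨x, hxK⟩ * ⟨k₂, hk₂⟩⁻¹ := Subtype.ext rfl
    rw [h2, map_mul, map_mul, map_inv] at h1
    have h3 : τ ⟨x, hxK⟩ = (τ ⟨k₂, hk₂⟩)⁻¹ * (τ ⟨k₂, hk₂⟩ * τ ⟨x, hxK⟩ * (τ ⟨k₂, hk₂⟩)⁻¹) * τ ⟨k₂, hk₂⟩ := by
      group
    rw [h3, h1]
    group
  · -- the generator `k₁⁻¹ θ(c'_{j₁}) k₁ ∈ K ∩ ⟨c₀⟩` is mapped to a conjugate of `z⁻¹ ≠ 1`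
    have hθc : θ (c j₁) ∈ peripheralSubgroup K (cusp j₁) (rep j₁) := by
      rw [← hcusps j₁]
      exact Subgroup.mem_map.mpr ⟨c j₁, Subgroup.mem_zpowers _, rfl⟩
    obtain ⟨hθcK, hθcI⟩ := Subgroup.mem_inf.mp hθc
    refine ⟨k₁⁻¹ * θ (c j₁) * k₁, K.mul_mem (K.mul_mem (K.inv_mem hk₁) hθcK) hk₁, ?_, ?_⟩
    · rw [hsub (cusp j₁), hrep₁] at hθcI
      obtain ⟨y, hy, hy'⟩ := Subgroup.mem_map.mp hθcI
      simp only [MulEquiv.coe_toMonoidHom, MulAut.conj_apply] at hy'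
      rw [← hy']
      have e : k₁⁻¹ * (k₁ * 1 * z₁ * y * (k₁ * 1 * z₁)⁻¹) * k₁ = z₁ * y * z₁⁻¹ := by group
      rw [e]
      exact (cuspInertia 0).mul_mem ((cuspInertia 0).mul_mem hz₁ hy) ((cuspInertia 0).inv_mem hz₁)
    · have h2 : (⟨k₁⁻¹ * θ (c j₁) * k₁, K.mul_mem (K.mul_mem (K.inv_mem hk₁) hθcK) hk₁⟩ : K) =
          ⟨k₁, hk₁⟩⁻¹ * eθ (c j₁) * ⟨k₁, hk₁⟩ := Subtype.ext (by rw [Subgroup.coe_mul, Subgroup.coe_mul,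
            Subgroup.coe_inv, heθ])
      rw [h2, map_mul, map_mul, map_inv, hτθ, hκ₁, hfc]
      intro h0
      apply hz1
      have h3 : (z : Multiplicative (ZMod ℓ × ZMod ℓ) ⋊[σ] Multiplicative (ZMod ℓ))⁻¹ =
          τ ⟨k₁, hk₁⟩ * ((τ ⟨k₁, hk₁⟩)⁻¹ * z⁻¹ * τ ⟨k₁, hk₁⟩) * (τ ⟨k₁, hk₁⟩)⁻¹ := by group
      rw [h0] at h3
      rw [← inv_eq_one, h3]
      group

/-- **One Heisenberg quotient separating a cusp of a finite covering from ALL the other cusps over the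
same cusp of the base.**  `h ≥ 1`, `K ≤ Γ_{h,1}` of finite index, `ℓ ≥ 2`: there is `τ : K → H_ℓ`
(Heisenberg mod `ℓ`, order `ℓ³`) NONTRIVIAL on `K ∩ ⟨c₀⟩` and killing `K ∩ β⟨c₀⟩β⁻¹` for EVERY
`β ∉ K·⟨c₀⟩` (collapse every cusp of `K ≅ Γ_{g',r'}` but the one over the sheet of `1`; `g' ≥ 1` by
Riemann–Hurwitz). [cite: ZieschangVogtColdewey1980, Thm 4.14.1 p.150] -/
theorem exists_hom_heisenberg_separating_peripherals {h : ℕ} (hh : 1 ≤ h) (ℓ : ℕ) [Fact (1 < ℓ)]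
    (K : Subgroup (PuncturedSurfaceGroup h 1)) [hK : K.FiniteIndex] :
    ∃ (σ : Multiplicative (ZMod ℓ) →* MulAut (Multiplicative (ZMod ℓ × ZMod ℓ)))
      (τ : K →* (Multiplicative (ZMod ℓ × ZMod ℓ) ⋊[σ] Multiplicative (ZMod ℓ))),
      Nat.card (Multiplicative (ZMod ℓ × ZMod ℓ) ⋊[σ] Multiplicative (ZMod ℓ)) = ℓ ^ 3 ∧
      (∀ β : PuncturedSurfaceGroup h 1, (∀ k ∈ K, ∀ z ∈ cuspInertia (0 : Fin 1), β ≠ k * z) →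
        ∀ (x : PuncturedSurfaceGroup h 1) (hxK : x ∈ K),
          x ∈ (cuspInertia (0 : Fin 1)).map (MulAut.conj β).toMonoidHom → τ ⟨x, hxK⟩ = 1) ∧
      ∃ (x : PuncturedSurfaceGroup h 1) (hxK : x ∈ K), x ∈ cuspInertia (0 : Fin 1) ∧ τ ⟨x, hxK⟩ ≠ 1 := by
  classical
  haveI : NeZero ℓ := ⟨by have := (Fact.out : 1 < ℓ); omega⟩
  have hyp : IsHyperbolicType h 1 := by unfold IsHyperbolicType; omega
  obtain ⟨g', r', θ, cusp, rep, hhyp', hθinj, hθrange, hformula, hcusps, hbij⟩ :=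
    puncturedSurfaceGroupFiniteIndexSubgroup_holds h 1 hyp K hK
  obtain ⟨j₁, ⟨-, k₁, hk₁, z₁, hz₁, hrep₁⟩, -⟩ := hbij 0 1
  have hsub : ∀ j : Fin 1, j = 0 := fun j => Fin.eq_zero j
  -- `r' ≤ [Γ : K]`, hence `g' ≥ 1`
  have hr'd : r' ≤ K.index := by
    let sh : Fin r' → PuncturedSurfaceGroup h 1 ⧸ K := fun j' => QuotientGroup.mk (rep j')⁻¹
    have hinj : Function.Injective sh := by
      intro i₁ i₂ he
      have hmem : ((rep i₁)⁻¹)⁻¹ * (rep i₂)⁻¹ ∈ K := QuotientGroup.eq.mp he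
      rw [inv_inv] at hmem
      obtain ⟨j', -, huniq⟩ := hbij (cusp i₁) (rep i₁)
      have h1 : i₁ = j' := huniq i₁ ⟨rfl, 1, K.one_mem, 1, (cuspInertia _).one_mem, by group⟩
      have h2 : i₂ = j' := huniq i₂ ⟨by rw [hsub (cusp i₂), hsub (cusp i₁)],
        (rep i₁ * (rep i₂)⁻¹)⁻¹, K.inv_mem hmem, 1, (cuspInertia _).one_mem, by group⟩
      rw [h1, h2]
    have hc := Nat.card_le_card_of_injective sh hinj
    rwa [Nat.card_eq_fintype_card, Fintype.card_fin] at hc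
  have hg' : 0 < g' := by
    have h3 : K.index * 3 ≤ K.index * (2 * h + 1) := Nat.mul_le_mul_left _ (by omega)
    omega
  obtain ⟨κ, hκ₁, hκ₂, -, -⟩ := exists_hom_collapseCusps (g := g') j₁
  obtain ⟨σ, f, hσ, -, hfc⟩ := exists_hom_heisenberg_surjective hg' ℓ
  let z : Multiplicative (ZMod ℓ × ZMod ℓ) ⋊[σ] Multiplicative (ZMod ℓ) :=
    SemidirectProduct.inl (ofAdd (0, 1))
  have hz1 : z ≠ 1 := by
    intro hz
    have h1 : (ofAdd ((0 : ZMod ℓ), (1 : ZMod ℓ))) = 1 :=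
      SemidirectProduct.inl_injective (hz.trans (map_one _).symm)
    have h2 := congrArg (fun q => (toAdd q).2) h1
    simp only [toAdd_ofAdd, toAdd_one, Prod.snd_zero] at h2
    exact one_ne_zero h2
  let eθ : PuncturedSurfaceGroup g' r' ≃* K :=
    (MonoidHom.ofInjective hθinj).trans (MulEquiv.subgroupCongr hθrange)
  have heθ : ∀ w, ((eθ w : K) : PuncturedSurfaceGroup h 1) = θ w := fun _ => rfl
  let τ : K →* (Multiplicative (ZMod ℓ × ZMod ℓ) ⋊[σ] Multiplicative (ZMod ℓ)) :=
    (f.comp κ).comp eθ.symm.toMonoidHom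
  have hτθ : ∀ w, τ (eθ w) = f (κ w) := fun w => by
    change f (κ (eθ.symm (eθ w))) = f (κ w)
    rw [MulEquiv.symm_apply_apply]
  have hperiph : ∀ (j' : Fin r') (x : PuncturedSurfaceGroup h 1),
      x ∈ peripheralSubgroup K (cusp j') (rep j') → ∃ n : ℤ, x = θ (c j' ^ n) := by
    intro j' x hx
    rw [← hcusps j'] at hx
    obtain ⟨w, hw, rfl⟩ := Subgroup.mem_map.mp hx
    obtain ⟨n, rfl⟩ := Subgroup.mem_zpowers_iff.mp hw
    exact ⟨n, rfl⟩
  have hcard : Nat.card (Multiplicative (ZMod ℓ × ZMod ℓ) ⋊[σ] Multiplicative (ZMod ℓ)) = ℓ ^ 3 := by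
    rw [Nat.card_congr SemidirectProduct.equivProd, Nat.card_prod, Nat.card_congr Multiplicative.toAdd,
      Nat.card_prod, Nat.card_zmod, Nat.card_congr Multiplicative.toAdd, Nat.card_zmod]
    ring
  refine ⟨σ, τ, hcard, fun β hβ x hxK hxβ => ?_, ?_⟩
  · -- the cusp of the sheet of `β` is some `j₂ ≠ j₁`; it is collapsed by `κ`
    obtain ⟨j₂, ⟨-, k₂, hk₂, z₂, hz₂, hrep₂⟩, -⟩ := hbij 0 β
    have hj : j₁ ≠ j₂ := by
      intro hj
      subst hj
      refine hβ (k₂⁻¹ * k₁) (K.mul_mem (K.inv_mem hk₂) hk₁) (z₁ * z₂⁻¹)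
        ((cuspInertia 0).mul_mem hz₁ ((cuspInertia 0).inv_mem hz₂)) ?_
      have e : k₁ * 1 * z₁ = k₂ * β * z₂ := hrep₁.symm.trans hrep₂
      calc β = k₂⁻¹ * (k₂ * β * z₂) * z₂⁻¹ := by group
        _ = k₂⁻¹ * (k₁ * 1 * z₁) * z₂⁻¹ := by rw [e]
        _ = k₂⁻¹ * k₁ * (z₁ * z₂⁻¹) := by group
    have hx' : k₂ * x * k₂⁻¹ ∈ peripheralSubgroup K (cusp j₂) (rep j₂) := by
      refine Subgroup.mem_inf.mpr ⟨K.mul_mem (K.mul_mem hk₂ hxK) (K.inv_mem hk₂), ?_⟩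
      rw [hsub (cusp j₂), hrep₂]
      obtain ⟨y, hy, rfl⟩ := Subgroup.mem_map.mp hxβ
      refine Subgroup.mem_map.mpr ⟨z₂⁻¹ * y * z₂, ?_, ?_⟩
      · exact (cuspInertia 0).mul_mem ((cuspInertia 0).mul_mem ((cuspInertia 0).inv_mem hz₂) hy) hz₂
      · simp only [MulEquiv.coe_toMonoidHom, MulAut.conj_apply]
        group
    obtain ⟨n, hn⟩ := hperiph j₂ _ hx'
    have hk₂x : (⟨k₂ * x * k₂⁻¹, K.mul_mem (K.mul_mem hk₂ hxK) (K.inv_mem hk₂)⟩ : K) = eθ (c j₂ ^ n) :=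
      Subtype.ext (by rw [heθ]; exact hn)
    have h1 : τ ⟨k₂ * x * k₂⁻¹, K.mul_mem (K.mul_mem hk₂ hxK) (K.inv_mem hk₂)⟩ = 1 := by
      rw [hk₂x, hτθ, map_zpow, map_zpow, hκ₂ j₂ (Ne.symm hj), map_one, one_zpow]
    have h2 : (⟨k₂ * x * k₂⁻¹, K.mul_mem (K.mul_mem hk₂ hxK) (K.inv_mem hk₂)⟩ : K) =
        ⟨k₂, hk₂⟩ * ⟨x, hxK⟩ * ⟨k₂, hk₂⟩⁻¹ := Subtype.ext rfl
    rw [h2, map_mul, map_mul, map_inv] at h1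
    have h3 : τ ⟨x, hxK⟩ = (τ ⟨k₂, hk₂⟩)⁻¹ * (τ ⟨k₂, hk₂⟩ * τ ⟨x, hxK⟩ * (τ ⟨k₂, hk₂⟩)⁻¹) * τ ⟨k₂, hk₂⟩ := by
      group
    rw [h3, h1]
    group
  · have hθc : θ (c j₁) ∈ peripheralSubgroup K (cusp j₁) (rep j₁) := by
      rw [← hcusps j₁]
      exact Subgroup.mem_map.mpr ⟨c j₁, Subgroup.mem_zpowers _, rfl⟩
    obtain ⟨hθcK, hθcI⟩ := Subgroup.mem_inf.mp hθc
    refine ⟨k₁⁻¹ * θ (c j₁) * k₁, K.mul_mem (K.mul_mem (K.inv_mem hk₁) hθcK) hk₁, ?_, ?_⟩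
    · rw [hsub (cusp j₁), hrep₁] at hθcI
      obtain ⟨y, hy, hy'⟩ := Subgroup.mem_map.mp hθcI
      simp only [MulEquiv.coe_toMonoidHom, MulAut.conj_apply] at hy'
      rw [← hy']
      have e : k₁⁻¹ * (k₁ * 1 * z₁ * y * (k₁ * 1 * z₁)⁻¹) * k₁ = z₁ * y * z₁⁻¹ := by group
      rw [e]
      exact (cuspInertia 0).mul_mem ((cuspInertia 0).mul_mem hz₁ hy) ((cuspInertia 0).inv_mem hz₁)
    · have h2 : (⟨k₁⁻¹ * θ (c j₁) * k₁, K.mul_mem (K.mul_mem (K.inv_mem hk₁) hθcK) hk₁⟩ : K) =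
          ⟨k₁, hk₁⟩⁻¹ * eθ (c j₁) * ⟨k₁, hk₁⟩ := Subtype.ext (by rw [Subgroup.coe_mul, Subgroup.coe_mul,
            Subgroup.coe_inv, heθ])
      rw [h2, map_mul, map_mul, map_inv, hτθ, hκ₁, hfc]
      intro h0
      apply hz1
      have h3 : (z : Multiplicative (ZMod ℓ × ZMod ℓ) ⋊[σ] Multiplicative (ZMod ℓ))⁻¹ =
          τ ⟨k₁, hk₁⟩ * ((τ ⟨k₁, hk₁⟩)⁻¹ * z⁻¹ * τ ⟨k₁, hk₁⟩) * (τ ⟨k₁, hk₁⟩)⁻¹ := by group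
      rw [h0] at h3
      rw [← inv_eq_one, h3]
      group

end Literature.GroupTheory.CombinatorialGroupTheory.PuncturedSurfaceGroup
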